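import Summits.ValiantsHypothesis.ValiantsHypothesis.Theorems.GrenetZeonDualUnipotentThreeHalvesHeavyTopWeightShadowDefs

/-!
# `GrenetZeon.DualUnipotentThreeHalves` (stmt-ValiantsHypothesis-24318), R2 `HeavyTopLaw` — PORT of val-idea-27's
# `Cruxes/DualUnipotentThreeHalves/WeightShadow.lean` @9b27f785c669 (cards «graded-shadow» / «pluecker-gap»), part (P1): conjugation / grading lemmas, ★ L2 `oppositeWeight_trace`, ★ L3 `gradedMassCriterion`

VERBATIM PORT (desk RULING #313 / director R282 (3); writer val-port-4 g2; AUTHOR OF THE MATHEMATICS AND THE LEAN TEXT: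
val-idea-27 — every statement and proof below is idea-27's, byte-identical apart from the namespace
`…Theorems.GrenetZeon.WeightShadow` and added one-line docstrings where the source had none).  This file: `conj_mul`, `conj_sub`, `trace_conj`, `flagCheap_of_certifies` (a certificate ⇒ `FlagCheap`, over ✓ `flagCheap_of_weight_levels`), `conj_inv_conj`, `conj_conj_inv`, `isGraded_of_isGradedPencil`, `gradedHeavyTopLaw_of_heavyTopLaw`, `pencilSpace_le_sup`, `isNilpotent_of_mem_pencilSpace`, L2 `oppositeWeight_trace` (opposite weight components of a graded nilpotent pencil are trace-orthogonal), L3 `gradedMassCriterion` (G″ read through a coarsening of the pencil's own grading).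

NOT ported (stay in `Cruxes/`): `stub_threeWeightLaw` (L4 = the law `ThreeWeightLaw`, research rung), the L1 appendix
(`gradedCertificate` over four linear-algebra stubs), the K1c-refuted section.  HONEST LABEL: helper-currency port of an
ideator's SORRY-FREE lemmas; nothing here bears on R2 `HeavyTopLaw`, 24318, S3b or 8062 beyond what the Cruxes file already
said; `VP ≠ VNP` is NOT proved; no summit statement is proved here.  No named facts.
-/

noncomputable section

-- single-conjunct layout: Sub = Summit, duplicated namespace component intended
set_option linter.dupNamespace false

namespace Summit.ValiantsHypothesis.ValiantsHypothesis.Theorems.GrenetZeon.WeightShadow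

open MvPolynomial Matrix
open scoped BigOperators
open Summit.ValiantsHypothesis.ValiantsHypothesis.Cruxes.TwoDimCoefficients.DimTwoCases (AffMat IsAffine)
open Summit.ValiantsHypothesis.ValiantsHypothesis.Theorems.GrenetZeon.RadicalSplit

variable {m : ℕ}

/-- `conj` is multiplicative. -/
theorem conj_mul (P : (Matrix (Fin m) (Fin m) ℂ)ˣ) (X Y : Matrix (Fin m) (Fin m) ℂ) :
    conj P (X * Y) = conj P X * conj P Y := by
  simp only [conj, Matrix.mul_assoc]
  rw [← Matrix.mul_assoc (↑P⁻¹ : Matrix (Fin m) (Fin m) ℂ) (P : Matrix (Fin m) (Fin m) ℂ), Units.inv_mul, Matrix.one_mul]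

/-- `conj_sub` (val-idea-27, `WeightShadow.lean` @9b27f785c669; ported verbatim). -/
theorem conj_sub (P : (Matrix (Fin m) (Fin m) ℂ)ˣ) (X Y : Matrix (Fin m) (Fin m) ℂ) :
    conj P (X - Y) = conj P X - conj P Y := by
  simp [conj, Matrix.mul_sub, Matrix.sub_mul]

/-- `trace_conj` (val-idea-27, `WeightShadow.lean` @9b27f785c669; ported verbatim). -/
theorem trace_conj (P : (Matrix (Fin m) (Fin m) ℂ)ˣ) (M : Matrix (Fin m) (Fin m) ℂ) :
    Matrix.trace (conj P M) = Matrix.trace M := by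
  simp only [conj]
  rw [Matrix.trace_mul_cycle, Units.inv_mul, Matrix.one_mul]

/-- A certified pencil is flag-cheap (G″ verbatim). PROVED. -/
theorem flagCheap_of_certifies {n : ℕ} {N : AffMat n m} (hN : IsAffine N) {P : (Matrix (Fin m) (Fin m) ℂ)ˣ}
    {lvl : Fin m → ℕ} {p r c : ℕ} {K : Submodule ℂ (Fin n × Fin n → ℂ)} (h : Certifies N P lvl p r c K) :
    FlagCheap n m N := by
  obtain ⟨hc, hlvl, hdrop, hK, hdim⟩ := h
  exact Theorems.GrenetZeon.HeavyTopInvariantFlag.flagCheap_of_weight_levels N hN P lvl p r c hc hlvl hdrop K hK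
    _ le_rfl hdim

/-- A graded affine pencil has a graded pencil space (linear algebra: `wtComp` is linear, `pencilSpace` is a span). -/
theorem conj_inv_conj (P : (Matrix (Fin m) (Fin m) ℂ)ˣ) (M : Matrix (Fin m) (Fin m) ℂ) :
    conj P⁻¹ (conj P M) = M := by
  simp only [conj, inv_inv]
  calc (↑P⁻¹ : Matrix (Fin m) (Fin m) ℂ) * ((P : Matrix (Fin m) (Fin m) ℂ) * M * (↑P⁻¹ : Matrix (Fin m) (Fin m) ℂ)) *
        (P : Matrix (Fin m) (Fin m) ℂ)
      = ((↑P⁻¹ : Matrix (Fin m) (Fin m) ℂ) * (P : Matrix (Fin m) (Fin m) ℂ)) * M *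
        ((↑P⁻¹ : Matrix (Fin m) (Fin m) ℂ) * (P : Matrix (Fin m) (Fin m) ℂ)) := by simp only [Matrix.mul_assoc]
    _ = M := by rw [Units.inv_mul, Matrix.one_mul, Matrix.mul_one]

/-- `conj_conj_inv` (val-idea-27, `WeightShadow.lean` @9b27f785c669; ported verbatim). -/
theorem conj_conj_inv (P : (Matrix (Fin m) (Fin m) ℂ)ˣ) (M : Matrix (Fin m) (Fin m) ℂ) :
    conj P (conj P⁻¹ M) = M := by
  simp only [conj, inv_inv]
  calc (P : Matrix (Fin m) (Fin m) ℂ) * ((↑P⁻¹ : Matrix (Fin m) (Fin m) ℂ) * M * (P : Matrix (Fin m) (Fin m) ℂ)) *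
        (↑P⁻¹ : Matrix (Fin m) (Fin m) ℂ)
      = ((P : Matrix (Fin m) (Fin m) ℂ) * (↑P⁻¹ : Matrix (Fin m) (Fin m) ℂ)) * M *
        ((P : Matrix (Fin m) (Fin m) ℂ) * (↑P⁻¹ : Matrix (Fin m) (Fin m) ℂ)) := by simp only [Matrix.mul_assoc]
    _ = M := by rw [Units.mul_inv, Matrix.one_mul, Matrix.mul_one]

/-- A graded affine pencil has a graded pencil space (PROVED v1.6; linear algebra: the weight projector
`M ↦ P⁻¹ (P M P⁻¹)_d P` is linear and maps the generators of `pencilSpace N` into it). -/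
theorem isGraded_of_isGradedPencil {n : ℕ} (N : AffMat n m) (P : (Matrix (Fin m) (Fin m) ℂ)ˣ) (lvl : Fin m → ℕ)
    (h : IsGradedPencil N P lvl) : IsGraded N P lvl := by
  obtain ⟨htop, d₀, hd₀⟩ := h
  intro M hM d
  have hadd : ∀ X Y : Matrix (Fin m) (Fin m) ℂ, conj P⁻¹ (wtComp lvl d (conj P (X + Y))) =
      conj P⁻¹ (wtComp lvl d (conj P X)) + conj P⁻¹ (wtComp lvl d (conj P Y)) := by
    intro X Y
    have e : wtComp lvl d (conj P (X + Y)) = wtComp lvl d (conj P X) + wtComp lvl d (conj P Y) := by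
      ext i j
      simp only [wtComp, conj, Matrix.of_apply, Matrix.add_apply, Matrix.mul_add, Matrix.add_mul]
      split_ifs <;> simp
    rw [e]
    simp [conj, Matrix.mul_add, Matrix.add_mul]
  have hsmul : ∀ (a : ℂ) (X : Matrix (Fin m) (Fin m) ℂ), conj P⁻¹ (wtComp lvl d (conj P (a • X))) =
      a • conj P⁻¹ (wtComp lvl d (conj P X)) := by
    intro a X
    have e : wtComp lvl d (conj P (a • X)) = a • wtComp lvl d (conj P X) := by
      ext i j
      simp only [wtComp, conj, Matrix.of_apply, Matrix.smul_apply, Matrix.mul_smul, Matrix.smul_mul]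
      split_ifs <;> simp
    rw [e]
    simp [conj]
  induction hM using Submodule.span_induction with
  | mem x hx =>
      rcases hx with hx | ⟨v, rfl⟩
      · rw [Set.mem_singleton_iff] at hx
        subst hx
        by_cases hd : d = d₀
        · subst hd
          rw [hd₀, conj_inv_conj]
          exact Submodule.subset_span (Or.inl rfl)
        · have e : wtComp lvl d (conj P (N.map (MvPolynomial.eval 0))) = 0 := by
            rw [← hd₀]
            ext i j
            simp only [wtComp, Matrix.of_apply, Matrix.zero_apply]
            split_ifs with h1 h2
            · exact absurd (h1.symm.trans h2) hd
            · rfl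
            · rfl
          rw [e]
          simp [conj]
      · obtain ⟨v', hv'⟩ := htop v d
        rw [hv']
        exact Submodule.subset_span (Or.inr ⟨v', rfl⟩)
  | zero =>
      have e : wtComp lvl d (conj P 0) = 0 := by
        ext i j; simp [wtComp, conj]
      rw [e]
      simp [conj]
  | add x y _ _ hx hy => rw [hadd]; exact add_mem hx hy
  | smul a x _ hx => rw [hsmul]; exact Submodule.smul_mem _ a hx

/-- GHTL is a sub-case of R2 (sanity: the restriction is by an extra hypothesis). -/
theorem gradedHeavyTopLaw_of_heavyTopLaw : HeavyTopLaw → GradedHeavyTopLaw := by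
  rintro ⟨C₀, n₀, h⟩
  exact ⟨C₀, n₀, fun n hn m hm N hN hnil _ hK => h n hn m hm N hN hnil hK⟩

/-- **Opposite weights are trace-orthogonal** on a graded nilpotent pencil (`tr(XY) = 0` on `W` — the `k = 1` symmetrised
trace identity — applied to homogeneous components, which lie in `W` by gradedness).  The first inequality of the
mass calculus: `μ(d) + μ(−d) ≤ dim gl_m(d)`. -/
theorem pencilSpace_le_sup {n : ℕ} (N : AffMat n m) (T : (Fin n × Fin n → ℂ) →ₗ[ℂ] Matrix (Fin m) (Fin m) ℂ)
    (hT : ∀ v, T v = linPart N v) :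
    pencilSpace N ≤ Submodule.span ℂ {N.map (MvPolynomial.eval 0)} ⊔ LinearMap.range T := by
  apply Submodule.span_le.2
  rintro M (hM | ⟨v, rfl⟩)
  · exact Submodule.mem_sup_left (Submodule.subset_span hM)
  · apply Submodule.mem_sup_right
    rw [← hT]
    exact LinearMap.mem_range_self T v

/-- The pencil space of an affine nilpotent pencil is a nil space (✓ `isNilpotent_of_mem_span_sup_range`, GradedFlag). -/
theorem isNilpotent_of_mem_pencilSpace {n : ℕ} (N : AffMat n m) (hN : IsAffine N) (hnil : N ^ m = 0)
    {M : Matrix (Fin m) (Fin m) ℂ} (hM : M ∈ pencilSpace N) : IsNilpotent M := by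
  obtain ⟨T, hT⟩ := exists_topMap_linPart N hN
  exact Summit.ValiantsHypothesis.ValiantsHypothesis.Theorems.GrenetZeon.HeavyTopGradedFlag.isNilpotent_of_mem_span_sup_range
    N hN hnil T hT M (pencilSpace_le_sup N T hT hM)

/-- **Opposite weights are trace-orthogonal (L2 — PROVED v1.6)** on a graded nilpotent pencil: the homogeneous components of
elements of `W` are conjugates of elements of `W` (gradedness), `W` is a nil SPACE, and `tr(AB) = 0` for `A, B` in a nil space
(✓ `trace_pow_mul_eq_zero_of_pencil`, k = 1).  First inequality of the mass calculus: `μ(d) + μ(−d) ≤ dim gl_m(d)`. -/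
theorem oppositeWeight_trace {n : ℕ} (N : AffMat n m) (hN : IsAffine N) (hnil : N ^ m = 0)
    (P : (Matrix (Fin m) (Fin m) ℂ)ˣ) (lvl : Fin m → ℕ) (hgr : IsGraded N P lvl)
    (M M' : Matrix (Fin m) (Fin m) ℂ) (hM : M ∈ pencilSpace N) (hM' : M' ∈ pencilSpace N) (d : ℤ) :
    Matrix.trace (wtComp lvl d (conj P M) * wtComp lvl (-d) (conj P M')) = 0 := by
  have hA := hgr M hM d
  have hB := hgr M' hM' (-d)
  rw [← conj_conj_inv P (wtComp lvl d (conj P M)), ← conj_conj_inv P (wtComp lvl (-d) (conj P M')), ← conj_mul,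
    trace_conj]
  have h := trace_pow_mul_eq_zero_of_pencil (conj P⁻¹ (wtComp lvl d (conj P M)))
    (conj P⁻¹ (wtComp lvl (-d) (conj P M')))
    (fun t => isNilpotent_of_mem_pencilSpace N hN hnil (Submodule.add_mem _ hA (Submodule.smul_mem _ t hB))) 1
  simpa using h

/-- **Graded mass criterion (L3 — PROVED v1.6)** (G″ read on a graded pencil through a COARSENING of its own grading by the scale `s`):
drop depth `r₀`, `p` fine levels; if the tops of fine weight `≥ s` have codimension `< j·n` and
`p + r₀·j ≤ s·(n − 2j) − 2s`, the pencil is flag-cheap.  Proof: `flagCheap_of_weight_levels` with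
`lvl' = lvl / s`, `p' = (p−1)/s + 1`, `r' = ⌈r₀/s⌉`, `c' = 1`, `k = (p'−1 + r'(n−1))/(1+r') ≤ n − j − 1`. -/
theorem gradedMassCriterion {n : ℕ} (N : AffMat n m) (hN : IsAffine N)
    (P : (Matrix (Fin m) (Fin m) ℂ)ˣ) (lvl : Fin m → ℕ) (p r₀ s j : ℕ) (hs : 1 ≤ s) (hlvl : ∀ i, lvl i < p)
    (hdrop : ∀ i j : Fin m, lvl i + r₀ < lvl j →
      ((P : Matrix (Fin m) (Fin m) ℂ).map C * N * (↑P⁻¹ : Matrix (Fin m) (Fin m) ℂ).map C :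
        Matrix (Fin m) (Fin m) (MvPolynomial (Fin n × Fin n) ℂ)) i j = 0)
    (K : Submodule ℂ (Fin n × Fin n → ℂ))
    (hK : ∀ v ∈ K, ∀ i j : Fin m, wt lvl i j < s → conj P (linPart N v) i j = 0)
    (hscale : p + r₀ * j + 2 * s ≤ s * (n - 2 * j)) (hmass : n ^ 2 < j * n + Module.finrank ℂ K) :
    FlagCheap n m N := by
  have hs0 : 0 < s := hs
  obtain ⟨s₁, rfl⟩ : ∃ s₁, s = s₁ + 1 := ⟨s - 1, by omega⟩
  set p'' := (p - 1) / (s₁ + 1) with hp''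
  set r' := (r₀ + s₁) / (s₁ + 1) with hr'
  have F1 : (s₁ + 1) * p'' ≤ p := (Nat.mul_div_le (p - 1) (s₁ + 1)).trans (Nat.sub_le p 1)
  have F2 : (s₁ + 1) * r' ≤ r₀ + s₁ := Nat.mul_div_le (r₀ + s₁) (s₁ + 1)
  have F3 : r₀ ≤ (s₁ + 1) * r' := by
    have h := Nat.lt_mul_div_succ (r₀ + s₁) hs0
    rw [Nat.mul_add, Nat.mul_one, ← hr'] at h
    omega
  -- the format forces `n ≥ 2j + 2`
  have hn2 : 2 * j + 2 ≤ n := by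
    by_contra hcon
    have h1 : n - 2 * j ≤ 1 := by omega
    have h2 := Nat.mul_le_mul_left (s₁ + 1) h1
    rw [Nat.mul_one] at h2
    omega
  obtain ⟨t, ht⟩ : ∃ t, n = 2 * j + 2 + t := ⟨n - (2 * j + 2), by omega⟩
  have hsc : p + r₀ * j + 2 * (s₁ + 1) ≤ (s₁ + 1) * (t + 2) := by
    have e : n - 2 * j = t + 2 := by omega
    rw [e] at hscale
    exact hscale
  -- main inequality `X := p'' + r'·j ≤ n − j − 2`
  have hX : p'' + r' * j ≤ j + t := by
    have h1 : (s₁ + 1) * (p'' + r' * j) ≤ (s₁ + 1) * (j + t) := by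
      nlinarith [Nat.mul_le_mul_right j F2, F1, hsc]
    exact Nat.le_of_mul_le_mul_left h1 hs0
  -- the G″ budget `k ≤ n − j − 1`
  set k := (p'' + r' * (n - 1)) / (1 + r') with hk
  have hk_le : k ≤ j + t + 1 := by
    apply Nat.div_le_of_le_mul
    have e : n - 1 = 2 * j + 1 + t := by omega
    rw [e]
    nlinarith [hX]
  have hdim : (k + 1) * n < Module.finrank ℂ K := by
    have h1 : (k + 1) * n ≤ (j + t + 2) * n := Nat.mul_le_mul_right n (by omega)
    have h2 : (j + t + 2) * n + j * n = n ^ 2 := by rw [ht]; ring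
    omega
  refine Theorems.GrenetZeon.HeavyTopInvariantFlag.flagCheap_of_weight_levels N hN P (fun i => lvl i / (s₁ + 1))
    (p'' + 1) r' 1 le_rfl ?_ ?_ K ?_ k (by simp [hk]) hdim
  · -- levels
    intro i
    have h : lvl i / (s₁ + 1) ≤ (p - 1) / (s₁ + 1) := Nat.div_le_div_right (by have := hlvl i; omega)
    show lvl i / (s₁ + 1) < p'' + 1
    omega
  · -- drops: `⌊lvl i/s⌋ + r' < ⌊lvl j/s⌋ ⇒ lvl i + r₀ < lvl j`
    intro i j' hij
    apply hdrop i j'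
    have a1 := Nat.lt_mul_div_succ (lvl i) hs0
    have a2 := Nat.mul_div_le (lvl j') (s₁ + 1)
    have hij' : lvl i / (s₁ + 1) + r' + 1 ≤ lvl j' / (s₁ + 1) := hij
    have a3 := Nat.mul_le_mul_left (s₁ + 1) hij'
    rw [Nat.mul_add, Nat.mul_add, Nat.mul_one] at a3
    rw [Nat.mul_add, Nat.mul_one] at a1
    generalize (s₁ + 1) * (lvl i / (s₁ + 1)) = A at a1 a3
    generalize (s₁ + 1) * (lvl j' / (s₁ + 1)) = B at a2 a3
    generalize (s₁ + 1) * r' = R at F3 a3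
    omega
  · -- climbs: `⌊lvl i/s⌋ < ⌊lvl j/s⌋ + 1 ⇒ lvl i − lvl j < s`
    intro v hv i j' hij
    have h := hK v hv i j'
    simp only [conj] at h
    apply h
    simp only [wt]
    have a1 := Nat.lt_mul_div_succ (lvl i) hs0
    have a2 := Nat.mul_div_le (lvl j') (s₁ + 1)
    have a3 := Nat.mul_le_mul_left (s₁ + 1) (show lvl i / (s₁ + 1) ≤ lvl j' / (s₁ + 1) by omega)
    rw [Nat.mul_add, Nat.mul_one] at a1
    generalize (s₁ + 1) * (lvl i / (s₁ + 1)) = A at a1 a3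
    generalize (s₁ + 1) * (lvl j' / (s₁ + 1)) = B at a2 a3
    push_cast
    omega

end Summit.ValiantsHypothesis.ValiantsHypothesis.Theorems.GrenetZeon.WeightShadow

end
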